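import Literature.MathematicalPhysics.QuantumFieldTheory.BalabanImbrieJaffe1984to88.BIJ88RT51Density
import Literature.MathematicalPhysics.QuantumFieldTheory.BalabanImbrieJaffe1984to88.BIJ88RT51NoChange
import Literature.MathematicalPhysics.QuantumFieldTheory.BalabanImbrieJaffe1984to88.BIJ88RT51Unique

/-!
# `BalabanImbrieJaffe1984to88.BIJ88RT51Exists` — T. Bałaban, J. Imbrie, A. Jaffe, *Effective action and cluster properties of the
abelian Higgs model*, Commun. Math. Phys. **114** (1988) 257–315 [BalabanImbrieJaffe1988], Sect. 5.1 *Renormalization Transformation*,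
p. 277 [PDF 21]: **EXISTENCE (and a.e. uniqueness) of the density `ρ̃^L_{k+1}(v, ψ)` of (5.1.1)** — the renormalization transformation of
the GENERAL STEP (earlier fluctuation fields `{u^{(j)}}` integrated before `φ`, `ψ`-Gaussian centred at the BACKGROUND average `Q(u_k)φ`),
CONSTRUCTED as a sum of Radon–Nikodym densities and PROVED to satisfy the typed display (5.1.1), gen 5's `BIJ88RT51GeneralStep.IsRT511`
(resp. `IsRT511Ax` with the axial gauge conditions (5.1.4) inserted) — file 2/2 of seat p34 gen 6 (file 1/2 `BIJ88RT51Density`: the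
measure-level engine `rnC` and the smeared term densities `smear51`).

statement-level skeleton of published theorems with citation tags; proofs where landed; nothing here is a claim about the Yang–Mills mass gap

PDF held: `paper:balaban1988-cmp114-bij-abelian-higgs-effective-action` (journal page = PDF page + 256); p. 277 [PDF 21] read as an image
(r16's CCITT-G4 render `HOME/lit-balaban-r16/renders/cmp114/original-p021-x2.png`, re-read by this seat).

CITATION HEADER (lean-in-tree rule).  Part of the lit-balaban TYPED SKELETON (HOME `run/shared/lean/pub/lit-balaban/`), PHASE-2 proof seat
p34 gen 6 (unit `lit-balaban-p34-g6`; TAKING line HOME/STATUS.md 2026-08-21T07:13Z, free-target protocol G.5-34(d), own lineage = the C1/C2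
renormalization-transformation line of seat p34: `BIJ88Sect3Rescaling` · `BIJ85RT33` · `BIJ85RT37Normalization` · `BIJ88RT311Exists` ·
`BIJ88GaugeAverage`/`BIJ88RTIterated` · `BIJ88RT51GeneralStep`/`BIJ88RT51NoChange`/`BIJ88RT51BlockGauge`/`BIJ88RT51Unique` · `BIJ88RT51Density`).
Row served: **`C2.Eq5.1.1-5.1.4`** of `HOME/lit-balaban-r16/ROWS-C2-part2.md` (fold owner r16 = C2 Sect. 5), the EXISTENCE half (gen-5 hand-off
item (i): *"existence of ρ̃ for `IsRT511` with prev-dependent data"*).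

THE PRINTED TEXT (p. 277 [PDF 21], verbatim).  *"5.1. Renormalization Transformation.  A density of ρ̃^L_{k+1}(v, ψ) is obtained by
applying the renormalization transformations of [1] to ρ′_k as follows:
ρ̃^L_{k+1}(v, ψ) = Σ_{{X_ω}} T_L[∫ Π_{j=0}^{k−1} du^{(j)}_{Λ^{(j)c*}_{10}} T_{a,L,u_k} ρ′_k(u, φ, {X_ω}, {u^{(j)}})]
≡ Σ_{{X_ω}} ∫𝒟u δ(v/Qu) ∫ Π_{j=0}^{k−1} 𝒟u^{(j)}_{Λ^{(j)c*}_{10}} ∫𝒟φ × exp[−½aL⁻²⟨ψ − Q(u_k)φ, ψ − Q(u_k)φ⟩ − E^{(k)}] ρ′_k(u, φ, {X_ω}, {u^{(j)}}).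
(5.1.1)  Here a ≈ 1 is fixed throughout, and the normalization is E^{(k)} = −log(aL^{d−2}/2π). (5.1.2)"*.

CARRIERS (all of record; nothing re-declared).  Levels `k` (unit lattice: `u : GaugeField P k U1`, `φ : HiggsField P k`) and `k + 1` (block
lattice: `v`, `ψ`) of `Balaban1983to89.Setup`, standing range `k + 1 ≤ m + K` where needed; the earlier fields `{u^{(j)}}_{j<k}` =
`BIJ88InductiveForm41.Prev P k` with `prevMeasure`; `𝒟u` = `fieldMeasure P k U1`, `∫𝒟u δ_{Ax}(u)(·)` = r18's `BIJ88RenormTransf311.axialMeasure`,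
`𝒟φ`, `dψ` = Lebesgue, `dv` = `fieldMeasure P (k+1) U1`; `gaussWeight a c ψ` = the normalized `ψ`-Gaussian ((5.1.2) per site ↔ (3.12) total:
gen 5's `BIJ88RT51GeneralStep.E0step_level_eq_normE`); the typed display (5.1.1) = `IsRT511 terms Qu Qφ a ρ′ ρ̃`: for every bounded measurable `g`,
`∫dv∫dψ ρ̃(v, ψ) g(v, ψ) = Σ_{t∈terms} ∫𝒟u ∫Π𝒟u^{(j)} ∫𝒟φ ∫dψ ρ′_t({u^{(j)}}, u, φ) · gaussWeight_a(Q_t({u^{(j)}}, u, φ), ψ) · g(Qu, ψ)`, with DATA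
the finite term family `terms` (the large-field configurations `{X_ω}`), the term densities `ρ′_t`, the gauge-field block average `Qu` and
the background scalar averages `Q_t = Q(u_k)φ` (p. 274: `u_k` depends on `u` and on the `u^{(j)}`).

WHAT IS CONSTRUCTED / PROVED.
* §3 **THE DENSITY `ρ̃^L_{k+1}` := `rt51 ν terms Qu Qφ a ρ′` = `Σ_{t∈terms} rnC ν Qu G_t`** — for every term the complex Radon–Nikodym density
  w.r.t. `dv dψ` of the push-forward along `(u, ψ) ↦ (Qu, ψ)` of the `({u^{(j)}}, φ)`-smeared term density
  `G_t(u, ψ) = ∫Π𝒟u^{(j)} ∫𝒟φ ρ′_t gaussWeight_a(Q_t φ, ψ)` times `ν ⊗ dψ` (file 1/2), `ν` the `u`-measure; THE IDENTITY IT SATISFIES (`rt51_spec`: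
  the finite sum leaves the integrals, then per term file 1's `integral_rnC_mul` — the `δ`-function — and `integral_smear51_mul` — Fubini, a.e.
  in `u`); hence **`isRT511_rt51`** (`ν = 𝒟u`: the constructed density satisfies the printed, `δ_{Ax}`-free (5.1.1)) and **`isRT511Ax_rt51`**
  (`ν = 𝒟u δ_{Ax}`: it satisfies (5.1.1) with (5.1.4) inserted), for ANY finite term family with jointly measurable, `ν ⊗ Π𝒟u^{(j)} ⊗ 𝒟φ`-integrable
  `ρ′_t`, jointly measurable background kernels `Q_t`, `a > 0`, `d ≥ 2`, and measurable Haar-regular `Qu` (`(𝒟u).map Qu ≪ dv`, resp.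
  `(𝒟u δ_{Ax}).map Qu ≪ dv`); `integrable_rt51`, `measurable_rt51`.  With gen 5's a.e. uniqueness (`BIJ88RT51Unique.isRT511_unique`,
  `isRT511_congr_ae`): **`isRT511_iff_ae_eq_rt51`** / **`isRT511Ax_iff_ae_eq_rt51`** — a `dv dψ`-integrable `ρ̃` satisfies (5.1.1) IF AND ONLY IF
  it equals the constructed density `dv dψ`-a.e.: the display (5.1.1) DEFINES `ρ̃^L_{k+1}` as an `L¹(dv dψ)`-class, and this file exhibits it.
* §4 INSTANCES.  For the PRINTED gauge-field average `Qu` of [2] = [BalabanImbrieJaffe1985] (2.10) on the torus of record (r18's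
  `BIJ85BlockAveragesTorus.qU`) the Haar regularity is r18's `map_qU_fieldMeasure` / `absolutelyContinuous_map_qU` (the law of `Qu` under `𝒟u`,
  resp. `𝒟u δ_{Ax}`, IS `dv`): **`isRT511_rt51_printed`**, **`isRT511Ax_rt51_printed`** — no hypothesis on the block average left.  For the
  terms of r18's typed inductive form (4.1) (`BIJ88InductiveForm41.rhoPrime`, `Represents41`): **`bracket_eq_integral_rt51`** — `[F] = ∫dv dψ ρ̃^L_{k+1}`
  for the CONSTRUCTED `ρ̃^L_{k+1}`, i.e. gen 5's `BIJ88RT51NoChange.bracket_eq_integral_of_isRT511` with its hypothesis `IsRT511 …` discharged.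
NOT DONE HERE (honest scope).  As in gen 5's files the background kernels `Q_t = Q(u_k)φ`, `u_k`, the configurations `{X_ω}` and the term
densities `ρ′_k` are DATA (Sects. 4–5, r18/r16); their joint measurability and the integrability of `ρ′_t` are hypotheses (for the (4.1) terms
they depend on the Sect. 4 data `g_k`, `F_{k,loc}`, `χ_k`, `u_k`, `𝒫_{k,loc}`, which `Term41` carries as bare functions); the operators `T_L`,
`T_{a,L,u_k}` of [1] are not separate objects (only the displayed composite (5.1.1)); no bound.  One definition with body (`rt51`) and theorems;
re-declares nothing; imports Literature + Mathlib only; NO `Prop`-valued fact is introduced; standard axioms.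
-/

namespace Literature.MathematicalPhysics.QuantumFieldTheory.BalabanImbrieJaffe1984to88.BIJ88RT51Exists

open Literature.MathematicalPhysics.QuantumFieldTheory.Balaban1983to89
open BIJ88Sect3Statements (U1 cfg bracket)
open BIJ85Sect1Model (HiggsField)
open BIJ88RenormTransf311 (axialMeasure gaussWeight)
open BIJ88InductiveForm41 (Prev prevMeasure rhoPrime Represents41 Term41)
open BIJ88RT51GeneralStep (IsRT511 IsRT511Ax)
open BIJ88RT51NoChange (bracket_eq_integral_of_isRT511)
open BIJ88RT51Unique (isRT511_unique isRT511Ax_unique isRT511_congr_ae isRT511Ax_congr_ae)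
open BIJ88RT51Density (rnC smear51 measurable_rnC integrable_rnC integral_rnC_mul integrable_smear51 integral_smear51_mul)
open BIJ85BlockAveragesTorus (qU measurable_qU map_qU_fieldMeasure absolutelyContinuous_map_qU)
open scoped BigOperators ENNReal
open _root_.MeasureTheory _root_.MeasureTheory.Measure Complex Function

noncomputable section

variable {P : Params} {k : ℕ}

/-! ## §3 The density `ρ̃^L_{k+1}` of (5.1.1), constructed; it satisfies (5.1.1); it is the only one -/

section Exists

variable {ι : Type*} {terms : Finset ι} {ν : Measure (GaugeField P k U1)} {Qu : GaugeField P k U1 → GaugeField P (k+1) U1}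
variable {Qφ : ι → Prev P k → GaugeField P k U1 → HiggsField P k → HiggsField P (k+1)} {a : ℝ}
variable {ρ' : ι → Prev P k → GaugeField P k U1 → HiggsField P k → ℂ}

/-- **THE DENSITY `ρ̃^L_{k+1}(v, ψ)` OF (5.1.1), CONSTRUCTED**: the sum over the terms `{X_ω}` of the complex Radon–Nikodym densities w.r.t.
`dv dψ` of the push-forwards along `(u, ψ) ↦ (Qu, ψ)` of the smeared term densities `G_t(u, ψ) · (ν ⊗ dψ)` (file 1's `rnC`, `smear51`) — `ν = 𝒟u`
for the printed (5.1.1), `ν = 𝒟u δ_{Ax}(u)` for (5.1.1) with (5.1.4) inserted.  p. 277: *"A density of ρ̃^L_{k+1}(v, ψ) is obtained by applying the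
renormalization transformations of [1] to ρ′_k as follows"*. [cite: BalabanImbrieJaffe1988, (5.1.1) p.277] -/
def rt51 (ν : Measure (GaugeField P k U1)) (terms : Finset ι) (Qu : GaugeField P k U1 → GaugeField P (k+1) U1)
    (Qφ : ι → Prev P k → GaugeField P k U1 → HiggsField P k → HiggsField P (k+1)) (a : ℝ)
    (ρ' : ι → Prev P k → GaugeField P k U1 → HiggsField P k → ℂ) (V : GaugeField P (k+1) U1) (ψ : HiggsField P (k+1)) : ℂ :=
  ∑ t ∈ terms, rnC ν Qu (smear51 (Qφ t) a (ρ' t)) V ψ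

/-- kernel: unfolding `rt51` on the product. [cite: BalabanImbrieJaffe1988, (5.1.1) p.277] -/
theorem uncurry_rt51 : uncurry (rt51 ν terms Qu Qφ a ρ') = fun q => ∑ t ∈ terms, uncurry (rnC ν Qu (smear51 (Qφ t) a (ρ' t))) q := by
  funext q
  rfl

/-- kernel: the constructed density is jointly measurable in `(v, ψ)`. [cite: BalabanImbrieJaffe1988, (5.1.1) p.277] -/
theorem measurable_rt51 : Measurable (uncurry (rt51 ν terms Qu Qφ a ρ')) := by
  rw [uncurry_rt51]
  exact Finset.measurable_sum _ fun t _ => measurable_rnC _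

/-- **The constructed density is `dv dψ`-integrable** (for `ν ⊗ Π𝒟u^{(j)} ⊗ 𝒟φ`-integrable, jointly measurable term data; `a > 0`, `d ≥ 2`;
`ν` s-finite). [cite: BalabanImbrieJaffe1988, (5.1.1) p.277] -/
theorem integrable_rt51 [SFinite ν] (ha : 0 < a) (hd : 2 ≤ P.d)
    (hQφ : ∀ t ∈ terms, Measurable fun p : Prev P k × (GaugeField P k U1 × HiggsField P k) => Qφ t p.1 p.2.1 p.2.2)
    (hρm : ∀ t ∈ terms, Measurable fun p : Prev P k × (GaugeField P k U1 × HiggsField P k) => ρ' t p.1 p.2.1 p.2.2)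
    (hρi : ∀ t ∈ terms, Integrable (fun q : GaugeField P k U1 × (Prev P k × HiggsField P k) => ρ' t q.2.1 q.1 q.2.2)
      (ν.prod ((prevMeasure P k).prod volume))) :
    Integrable (uncurry (rt51 ν terms Qu Qφ a ρ')) ((fieldMeasure P (k+1) U1).prod volume) := by
  rw [uncurry_rt51]
  exact integrable_finsetSum _ fun t ht => integrable_rnC (integrable_smear51 ha hd (hQφ t ht) (hρm t ht) (hρi t ht))

/-- **THE IDENTITY SATISFIED BY THE CONSTRUCTED DENSITY** (both versions of (5.1.1) at once, `ν` the `u`-measure): for every bounded measurable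
test function `g(v, ψ)`,
`∫dv∫dψ ρ̃(v, ψ) g(v, ψ) = Σ_{t∈terms} ∫ν(du) ∫Π𝒟u^{(j)} ∫𝒟φ ∫dψ ρ′_t({u^{(j)}}, u, φ) gaussWeight_a(Q_t({u^{(j)}}, u, φ), ψ) g(Qu, ψ)`
— `ν` s-finite, `Qu` measurable with `ν.map Qu ≪ dv`, term data jointly measurable with `ρ′_t` `ν ⊗ Π𝒟u^{(j)} ⊗ 𝒟φ`-integrable, `a > 0`, `d ≥ 2`.
Mechanism: the finite sum leaves the integrals; per term file 1's `integral_rnC_mul` (the `δ`-function) and `integral_smear51_mul` (Fubini) a.e.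
in `u`. [cite: BalabanImbrieJaffe1988, (5.1.1) p.277] -/
theorem rt51_spec [SFinite ν] (ha : 0 < a) (hd : 2 ≤ P.d) (hQu : Measurable Qu) (hac : ν.map Qu ≪ fieldMeasure P (k+1) U1)
    (hQφ : ∀ t ∈ terms, Measurable fun p : Prev P k × (GaugeField P k U1 × HiggsField P k) => Qφ t p.1 p.2.1 p.2.2)
    (hρm : ∀ t ∈ terms, Measurable fun p : Prev P k × (GaugeField P k U1 × HiggsField P k) => ρ' t p.1 p.2.1 p.2.2)
    (hρi : ∀ t ∈ terms, Integrable (fun q : GaugeField P k U1 × (Prev P k × HiggsField P k) => ρ' t q.2.1 q.1 q.2.2)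
      (ν.prod ((prevMeasure P k).prod volume)))
    {g : GaugeField P (k+1) U1 × HiggsField P (k+1) → ℂ} (hg : Measurable g) {C : ℝ} (hC : ∀ z, ‖g z‖ ≤ C) :
    ∫ v, ∫ ψ, rt51 ν terms Qu Qφ a ρ' v ψ * g (v, ψ) ∂volume ∂fieldMeasure P (k+1) U1 =
      ∑ t ∈ terms, ∫ U, ∫ prev, ∫ φ, ∫ ψ, ρ' t prev U φ * (gaussWeight a (Qφ t prev U φ) ψ : ℂ) * g (Qu U, ψ)
        ∂volume ∂volume ∂prevMeasure P k ∂ν := by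
  have hGi : ∀ t ∈ terms, Integrable (smear51 (Qφ t) a (ρ' t)) (ν.prod volume) := fun t ht =>
    integrable_smear51 ha hd (hQφ t ht) (hρm t ht) (hρi t ht)
  have It : ∀ t ∈ terms, Integrable (fun q => uncurry (rnC ν Qu (smear51 (Qφ t) a (ρ' t))) q * g q)
      ((fieldMeasure P (k+1) U1).prod volume) := fun t ht =>
    (integrable_rnC (hGi t ht)).mul_bdd hg.aestronglyMeasurable (Filter.Eventually.of_forall hC)
  -- (1) the block side: the finite sum leaves the `dv dψ`-integral
  have e1 : ∀ v ψ, rt51 ν terms Qu Qφ a ρ' v ψ * g (v, ψ) =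
      ∑ t ∈ terms, uncurry (rnC ν Qu (smear51 (Qφ t) a (ρ' t))) (v, ψ) * g (v, ψ) := fun v ψ => by
    simp only [rt51, Finset.sum_mul, uncurry_apply_pair]
  simp_rw [e1]
  have hsum : Integrable (fun q => ∑ t ∈ terms, uncurry (rnC ν Qu (smear51 (Qφ t) a (ρ' t))) q * g q)
      ((fieldMeasure P (k+1) U1).prod volume) := integrable_finsetSum _ It
  have e2 : ∫ v, ∫ ψ, ∑ t ∈ terms, uncurry (rnC ν Qu (smear51 (Qφ t) a (ρ' t))) (v, ψ) * g (v, ψ) ∂volume ∂fieldMeasure P (k+1) U1 =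
      ∫ q, ∑ t ∈ terms, uncurry (rnC ν Qu (smear51 (Qφ t) a (ρ' t))) q * g q ∂(fieldMeasure P (k+1) U1).prod volume :=
    (integral_prod _ hsum).symm
  rw [e2, integral_finsetSum _ It]
  refine Finset.sum_congr rfl fun t ht => ?_
  -- (2) one term: the `δ`-function, then Fubini a.e. in `u`
  have hGg : Integrable (fun p : GaugeField P k U1 × HiggsField P (k+1) => smear51 (Qφ t) a (ρ' t) p * g (Qu p.1, p.2))
      (ν.prod volume) :=
    (hGi t ht).mul_bdd ((hg.comp ((hQu.comp measurable_fst).prodMk measurable_snd)).aestronglyMeasurable)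
      (Filter.Eventually.of_forall fun p => hC _)
  rw [integral_rnC_mul hQu hac (hGi t ht) hg hC, integral_prod _ hGg]
  refine integral_congr_ae ?_
  filter_upwards [(hρi t ht).prod_right_ae] with U hU
  exact integral_smear51_mul ha hd (hQφ t ht) (hρm t ht) U hU (hg.comp measurable_prodMk_left) fun ψ => hC _

/-- **EXISTENCE for (5.1.1)** p. 277 [PDF 21] (printed text in the module docstring): for `a > 0`, `d ≥ 2`, a measurable gauge-field block
average `Qu` whose law under `𝒟u` is absolutely continuous w.r.t. `dv`, and a finite family of terms with jointly measurable background kernels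
`Q_t = Q(u_k)φ` and jointly measurable, `𝒟u ⊗ Π𝒟u^{(j)} ⊗ 𝒟φ`-integrable densities `ρ′_t`, THE CONSTRUCTED DENSITY `ρ̃^L_{k+1} = rt51 𝒟u …`
SATISFIES THE RENORMALIZATION TRANSFORMATION (5.1.1) OF THE GENERAL STEP, `IsRT511 terms Qu Qφ a ρ′ ρ̃^L_{k+1}`.
[cite: BalabanImbrieJaffe1988, (5.1.1) p.277] -/
theorem isRT511_rt51 (ha : 0 < a) (hd : 2 ≤ P.d) (hQu : Measurable Qu)
    (hac : (fieldMeasure P k U1).map Qu ≪ fieldMeasure P (k+1) U1)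
    (hQφ : ∀ t ∈ terms, Measurable fun p : Prev P k × (GaugeField P k U1 × HiggsField P k) => Qφ t p.1 p.2.1 p.2.2)
    (hρm : ∀ t ∈ terms, Measurable fun p : Prev P k × (GaugeField P k U1 × HiggsField P k) => ρ' t p.1 p.2.1 p.2.2)
    (hρi : ∀ t ∈ terms, Integrable (fun q : GaugeField P k U1 × (Prev P k × HiggsField P k) => ρ' t q.2.1 q.1 q.2.2)
      ((fieldMeasure P k U1).prod ((prevMeasure P k).prod volume))) :
    IsRT511 terms Qu Qφ a ρ' (rt51 (fieldMeasure P k U1) terms Qu Qφ a ρ') :=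
  fun _g hg hgC => hgC.elim fun _C hC => rt51_spec ha hd hQu hac hQφ hρm hρi hg hC

/-- **EXISTENCE for (5.1.1) WITH THE AXIAL GAUGE CONDITIONS (5.1.4) INSERTED**: the same with the `u`-measure `∫𝒟u δ_{Ax}(u)(·)` (r18's
`axialMeasure`) — Haar regularity `(𝒟u δ_{Ax}).map Qu ≪ dv`, integrability of `ρ′_t` for `𝒟u δ_{Ax} ⊗ Π𝒟u^{(j)} ⊗ 𝒟φ`; the constructed
`rt51 (𝒟u δ_{Ax}) …` satisfies `IsRT511Ax`. [cite: BalabanImbrieJaffe1988, (5.1.4) p.278] -/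
theorem isRT511Ax_rt51 (ha : 0 < a) (hd : 2 ≤ P.d) (hQu : Measurable Qu)
    (hac : (axialMeasure P k U1).map Qu ≪ fieldMeasure P (k+1) U1)
    (hQφ : ∀ t ∈ terms, Measurable fun p : Prev P k × (GaugeField P k U1 × HiggsField P k) => Qφ t p.1 p.2.1 p.2.2)
    (hρm : ∀ t ∈ terms, Measurable fun p : Prev P k × (GaugeField P k U1 × HiggsField P k) => ρ' t p.1 p.2.1 p.2.2)
    (hρi : ∀ t ∈ terms, Integrable (fun q : GaugeField P k U1 × (Prev P k × HiggsField P k) => ρ' t q.2.1 q.1 q.2.2)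
      ((axialMeasure P k U1).prod ((prevMeasure P k).prod volume))) :
    IsRT511Ax terms Qu Qφ a ρ' (rt51 (axialMeasure P k U1) terms Qu Qφ a ρ') :=
  fun _g hg hgC => hgC.elim fun _C hC => rt51_spec ha hd hQu hac hQφ hρm hρi hg hC

/-- **(5.1.1) DEFINES `ρ̃^L_{k+1}`**: under the hypotheses of `isRT511_rt51`, a `dv dψ`-integrable function `ρ̃(v, ψ)` satisfies the typed
(5.1.1) IF AND ONLY IF it coincides `dv dψ`-almost everywhere with the constructed density (gen 5's a.e. uniqueness
`BIJ88RT51Unique.isRT511_unique` and insensitivity to null modifications `isRT511_congr_ae`, with existence and integrability from this file).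
[cite: BalabanImbrieJaffe1988, (5.1.1) p.277] -/
theorem isRT511_iff_ae_eq_rt51 (ha : 0 < a) (hd : 2 ≤ P.d) (hQu : Measurable Qu)
    (hac : (fieldMeasure P k U1).map Qu ≪ fieldMeasure P (k+1) U1)
    (hQφ : ∀ t ∈ terms, Measurable fun p : Prev P k × (GaugeField P k U1 × HiggsField P k) => Qφ t p.1 p.2.1 p.2.2)
    (hρm : ∀ t ∈ terms, Measurable fun p : Prev P k × (GaugeField P k U1 × HiggsField P k) => ρ' t p.1 p.2.1 p.2.2)
    (hρi : ∀ t ∈ terms, Integrable (fun q : GaugeField P k U1 × (Prev P k × HiggsField P k) => ρ' t q.2.1 q.1 q.2.2)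
      ((fieldMeasure P k U1).prod ((prevMeasure P k).prod volume)))
    {ρL : GaugeField P (k+1) U1 → HiggsField P (k+1) → ℂ} (hρL : Integrable (uncurry ρL) ((fieldMeasure P (k+1) U1).prod volume)) :
    IsRT511 terms Qu Qφ a ρ' ρL ↔
      uncurry ρL =ᵐ[(fieldMeasure P (k+1) U1).prod volume] uncurry (rt51 (fieldMeasure P k U1) terms Qu Qφ a ρ') :=
  ⟨fun h => isRT511_unique h (isRT511_rt51 ha hd hQu hac hQφ hρm hρi) hρL (integrable_rt51 ha hd hQφ hρm hρi),
    fun h => isRT511_congr_ae (isRT511_rt51 ha hd hQu hac hQφ hρm hρi) (integrable_rt51 ha hd hQφ hρm hρi) hρL h⟩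

/-- The same characterization for (5.1.1) with the axial gauge conditions (5.1.4) inserted. [cite: BalabanImbrieJaffe1988, (5.1.4) p.278] -/
theorem isRT511Ax_iff_ae_eq_rt51 (ha : 0 < a) (hd : 2 ≤ P.d) (hQu : Measurable Qu)
    (hac : (axialMeasure P k U1).map Qu ≪ fieldMeasure P (k+1) U1)
    (hQφ : ∀ t ∈ terms, Measurable fun p : Prev P k × (GaugeField P k U1 × HiggsField P k) => Qφ t p.1 p.2.1 p.2.2)
    (hρm : ∀ t ∈ terms, Measurable fun p : Prev P k × (GaugeField P k U1 × HiggsField P k) => ρ' t p.1 p.2.1 p.2.2)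
    (hρi : ∀ t ∈ terms, Integrable (fun q : GaugeField P k U1 × (Prev P k × HiggsField P k) => ρ' t q.2.1 q.1 q.2.2)
      ((axialMeasure P k U1).prod ((prevMeasure P k).prod volume)))
    {ρL : GaugeField P (k+1) U1 → HiggsField P (k+1) → ℂ} (hρL : Integrable (uncurry ρL) ((fieldMeasure P (k+1) U1).prod volume)) :
    IsRT511Ax terms Qu Qφ a ρ' ρL ↔
      uncurry ρL =ᵐ[(fieldMeasure P (k+1) U1).prod volume] uncurry (rt51 (axialMeasure P k U1) terms Qu Qφ a ρ') :=
  ⟨fun h => isRT511Ax_unique h (isRT511Ax_rt51 ha hd hQu hac hQφ hρm hρi) hρL (integrable_rt51 ha hd hQφ hρm hρi),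
    fun h => isRT511Ax_congr_ae (isRT511Ax_rt51 ha hd hQu hac hQφ hρm hρi) (integrable_rt51 ha hd hQφ hρm hρi) hρL h⟩

end Exists

/-! ## §4 Instances: the printed block average `Qu` of [2] (2.10); the terms of the inductive form (4.1) -/

section Instances

variable {ι : Type*} {terms : Finset ι}
variable {Qφ : ι → Prev P k → GaugeField P k U1 → HiggsField P k → HiggsField P (k+1)} {a : ℝ}
variable {ρ' : ι → Prev P k → GaugeField P k U1 → HiggsField P k → ℂ}

/-- **EXISTENCE for (5.1.1) WITH THE PRINTED GAUGE-FIELD AVERAGE `Qu`** ([2] (2.10) on the torus of record, r18's `BIJ85BlockAveragesTorus.qU`):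
its Haar regularity is r18's `map_qU_fieldMeasure` (the law of `Qu` under `𝒟u` IS `dv`; standing range), so NO hypothesis on the block average
remains — only the measurability / integrability of the term data. [cite: BalabanImbrieJaffe1988, (5.1.1) p.277] -/
theorem isRT511_rt51_printed (hk : k + 1 ≤ P.m + P.K) (ha : 0 < a) (hd : 2 ≤ P.d)
    (hQφ : ∀ t ∈ terms, Measurable fun p : Prev P k × (GaugeField P k U1 × HiggsField P k) => Qφ t p.1 p.2.1 p.2.2)
    (hρm : ∀ t ∈ terms, Measurable fun p : Prev P k × (GaugeField P k U1 × HiggsField P k) => ρ' t p.1 p.2.1 p.2.2)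
    (hρi : ∀ t ∈ terms, Integrable (fun q : GaugeField P k U1 × (Prev P k × HiggsField P k) => ρ' t q.2.1 q.1 q.2.2)
      ((fieldMeasure P k U1).prod ((prevMeasure P k).prod volume))) :
    IsRT511 terms qU Qφ a ρ' (rt51 (fieldMeasure P k U1) terms qU Qφ a ρ') :=
  isRT511_rt51 ha hd measurable_qU (Measure.absolutelyContinuous_of_eq (map_qU_fieldMeasure hk)) hQφ hρm hρi

/-- **EXISTENCE for (5.1.1)-with-(5.1.4) WITH THE PRINTED `Qu`**: Haar regularity in the axial gauge = r18's `absolutelyContinuous_map_qU`.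
[cite: BalabanImbrieJaffe1988, (5.1.4) p.278] -/
theorem isRT511Ax_rt51_printed (hk : k + 1 ≤ P.m + P.K) (ha : 0 < a) (hd : 2 ≤ P.d)
    (hQφ : ∀ t ∈ terms, Measurable fun p : Prev P k × (GaugeField P k U1 × HiggsField P k) => Qφ t p.1 p.2.1 p.2.2)
    (hρm : ∀ t ∈ terms, Measurable fun p : Prev P k × (GaugeField P k U1 × HiggsField P k) => ρ' t p.1 p.2.1 p.2.2)
    (hρi : ∀ t ∈ terms, Integrable (fun q : GaugeField P k U1 × (Prev P k × HiggsField P k) => ρ' t q.2.1 q.1 q.2.2)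
      ((axialMeasure P k U1).prod ((prevMeasure P k).prod volume))) :
    IsRT511Ax terms qU Qφ a ρ' (rt51 (axialMeasure P k U1) terms qU Qφ a ρ') :=
  isRT511Ax_rt51 ha hd measurable_qU (absolutelyContinuous_map_qU hk) hQφ hρm hρi

/-- **`[F] = ∫dv dψ ρ̃^L_{k+1}` FOR THE CONSTRUCTED DENSITY** (p. 274 [PDF 18] *"If we integrate this density over the u, φ variables, we
obtain our original unnormalized expectation [F]"* carried through the general step): if the terms `ρ′_k(·, ·, {X_ω}, ·)` of r18's typed
inductive form (4.1) (`BIJ88InductiveForm41.rhoPrime`) represent `[F]` (`Represents41`), are jointly measurable and `𝒟u ⊗ Π𝒟u^{(j)} ⊗ 𝒟φ`-integrable,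
then for the density `ρ̃^L_{k+1} = rt51 𝒟u …` obtained from them by (5.1.1) (measurable Haar-regular `Qu`, jointly measurable background kernels,
`a > 0`, `d ≥ 2`), `[F] = ∫dv dψ ρ̃^L_{k+1}` — gen 5's `BIJ88RT51NoChange.bracket_eq_integral_of_isRT511` with its hypothesis `IsRT511 …` DISCHARGED by
`isRT511_rt51`. [cite: BalabanImbrieJaffe1988, (5.1.1) p.277] -/
theorem bracket_eq_integral_rt51 (hd : 2 ≤ P.d) (ha : 0 < a) {T : ι → Term41 P k}
    {S : GaugeField P 0 U1 → (Balaban1983to89.Site P 0 → ℂ) → ℝ} {F : GaugeField P 0 U1 → (Balaban1983to89.Site P 0 → ℂ) → ℂ}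
    (h41 : Represents41 terms T S F) {Qu : GaugeField P k U1 → GaugeField P (k+1) U1} (hQu : Measurable Qu)
    (hac : (fieldMeasure P k U1).map Qu ≪ fieldMeasure P (k+1) U1)
    (hQφ : ∀ t ∈ terms, Measurable fun p : Prev P k × (GaugeField P k U1 × HiggsField P k) => Qφ t p.1 p.2.1 p.2.2)
    (hρm : ∀ t ∈ terms, Measurable fun p : Prev P k × (GaugeField P k U1 × HiggsField P k) => rhoPrime (T t) p.1 (cfg p.2.1) p.2.2)
    (hint : ∀ t ∈ terms, Integrable
      (fun q : GaugeField P k U1 × (Prev P k × HiggsField P k) => rhoPrime (T t) q.2.1 (cfg q.1) q.2.2)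
      ((fieldMeasure P k U1).prod ((prevMeasure P k).prod volume))) :
    bracket S F = ∫ v, ∫ ψ, rt51 (fieldMeasure P k U1) terms Qu Qφ a (fun t prev U φ => rhoPrime (T t) prev (cfg U) φ) v ψ
      ∂volume ∂fieldMeasure P (k+1) U1 :=
  bracket_eq_integral_of_isRT511 hd ha h41
    (isRT511_rt51 (ρ' := fun t prev U φ => rhoPrime (T t) prev (cfg U) φ) ha hd hQu hac hQφ hρm hint) hint

end Instances

end

end Literature.MathematicalPhysics.QuantumFieldTheory.BalabanImbrieJaffe1984to88.BIJ88RT51Exists
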